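import Summits.ResolutionOfSingularities.ResolutionOfSingularities.Theorems.MarkedTransferCampaignW46ExitTree
import Literature.AlgebraicGeometry.Resolution.QuadraticTransformsTransport
import HarnessLib

/-!
# Transport of the marked quadratic tree along a field isomorphism

[OURS · L1 W4.6 rung (i-a)′, INVARIANT layer — cell res-hironaka, LADDER-RESOLUTION rung L, D-0089; campaign s46,
seat res-D-pv-044 AS res-L1-s46-pv-8; host route MarkedTransfer, `--supports stmt-ResolutionOfSingularities-16156
--as helper`.] HONEST FRAMING: nothing here is a statement of H. Hironaka's manuscript (2017-03-23, [Hironaka2017]);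
pure commutative algebra, continuing `MarkedTransferCampaignW46ExitTree.lean`. AI-written; weaker than expert
review. No `sorry`; axioms standard.

The exit count `exitCount b S J` of the marked quadratic tree is computed inside a fixed field `K ⊇ S`
(`Frac S = K`). Along a run of point blow-ups the function field changes by isomorphisms
(`K(Z_{k+1}) ≅ K(Z_k)`), and the germ invariant of res-L1-s46-pv-9's glue is a function of an ABSTRACT local ring;
so the count must be transported along field isomorphisms `φ : K ≃+* L`: `S ↦ φ(S)`, `J ↦ φ(J)`. PROVED:

* `MarkedNode.ext_of_image` — two marked nodes with the same ring and the same image of the marked ideal in `K`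
  are equal (sigma-type bookkeeping);
* `nodeMap φ` and its round trip `nodeMap_symm_nodeMap`; invariance of `IsSingularNode`, `IsTameNode`,
  `IsQuadraticTransform` (the tree's `isQuadraticTransform_comap`), `extIdeal`, `ctrlTransform`, `MarkedStep`,
  reachability and `exitTree` under `nodeMap φ`;
* **`exitCount_map_ringEquiv`** — `exitCount b (φ S) (φ J) = exitCount b S J`.

## References

* O. Zariski, P. Samuel, *Commutative Algebra* II (1960), Appendix 5. [ZariskiSamuel1960]
-/

noncomputable section

open IsLocalRing

-- single-problem summit: the doubled namespace component `ResolutionOfSingularities` is forced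
set_option linter.dupNamespace false

namespace Summit.ResolutionOfSingularities.ResolutionOfSingularities.Theorems.CampaignW46

open Literature.AlgebraicGeometry.Resolution

universe u

variable {K L : Type u} [Field K] [Field L]

/-! ## Sigma-type bookkeeping for marked nodes -/

/-- Two marked nodes with the same underlying subring and the same image of the marked ideal in `K` are equal.
[folklore] -/
theorem MarkedNode.ext_of_image {n m : MarkedNode K} (h1 : n.1 = m.1)
    (h2 : ((↑) : n.1 → K) '' (n.2 : Set n.1) = ((↑) : m.1 → K) '' (m.2 : Set m.1)) : n = m := by
  obtain ⟨S, J⟩ := n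
  obtain ⟨S', J'⟩ := m
  dsimp only at h1
  subst h1
  dsimp only at h2
  congr
  ext z
  constructor
  · intro hz
    have : (z : K) ∈ ((↑) : S → K) '' (J' : Set S) := h2 ▸ ⟨z, hz, rfl⟩
    obtain ⟨z', hz', e⟩ := this
    rwa [← Subtype.ext e]
  · intro hz
    have : (z : K) ∈ ((↑) : S → K) '' (J : Set S) := h2.symm ▸ ⟨z, hz, rfl⟩
    obtain ⟨z', hz', e⟩ := this
    rwa [← Subtype.ext e]

/-- A ring isomorphism followed by its inverse is the identity on ideals. [folklore] -/
theorem map_map_symm_of_equiv {A B : Type*} [CommRing A] [CommRing B] (e : A ≃+* B) (I : Ideal A) :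
    (I.map e).map e.symm = I := by
  ext x
  constructor
  · intro hx
    obtain ⟨y, hy, rfl⟩ := (Ideal.mem_map_of_equiv e.symm _).mp hx
    obtain ⟨z, hz, rfl⟩ := (Ideal.mem_map_of_equiv e _).mp hy
    rwa [e.symm_apply_apply]
  · intro hx
    exact (Ideal.mem_map_of_equiv _ _).mpr ⟨e x, Ideal.mem_map_of_mem _ hx, e.symm_apply_apply x⟩

/-- Colon ideals transport along a ring isomorphism. [folklore] -/
theorem map_colon_of_equiv {A B : Type*} [CommRing A] [CommRing B] (e : A ≃+* B) (N P : Ideal A) :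
    (Submodule.colon N (P : Set A)).map e = Submodule.colon (N.map e) ((P.map e : Ideal B) : Set B) := by
  ext w
  constructor
  · intro hw
    obtain ⟨v, hv, rfl⟩ := (Ideal.mem_map_of_equiv e w).mp hw
    refine Submodule.mem_colon.mpr fun p hp => ?_
    obtain ⟨q, hq, rfl⟩ := (Ideal.mem_map_of_equiv e p).mp hp
    rw [smul_eq_mul, ← map_mul]
    have := (Submodule.mem_colon.mp hv) q hq
    rw [smul_eq_mul] at this
    exact Ideal.mem_map_of_mem _ this
  · intro hw
    refine (Ideal.mem_map_of_equiv e w).mpr ⟨e.symm w, ?_, e.apply_symm_apply w⟩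
    refine Submodule.mem_colon.mpr fun q hq => ?_
    have := (Submodule.mem_colon.mp hw) (e q) (Ideal.mem_map_of_mem _ hq)
    rw [smul_eq_mul] at this ⊢
    obtain ⟨v, hv, hve⟩ := (Ideal.mem_map_of_equiv e _).mp this
    have : v = e.symm w * q := e.injective (by rw [hve, map_mul, e.apply_symm_apply])
    rwa [this] at hv

/-! ## The restricted isomorphism `S ≃+* φ(S)` and images of ideals -/

/-- The field isomorphism restricted to a subring. [folklore] -/
abbrev subringMapEquiv (φ : K ≃+* L) (S : Subring K) : S ≃+* S.map (φ : K →+* L) :=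
  S.equivMapOfInjective (φ : K →+* L) φ.injective

/-- The restricted isomorphism is `φ` on elements. [folklore] -/
@[simp] theorem coe_subringMapEquiv (φ : K ≃+* L) (S : Subring K) (z : S) :
    ((subringMapEquiv φ S z : S.map (φ : K →+* L)) : L) = φ z := rfl

/-- The image in `L` of the transported ideal is `φ` of the image in `K`. [folklore] -/
theorem coe_image_map_subringMapEquiv (φ : K ≃+* L) (S : Subring K) (J : Ideal S) :
    ((↑) : S.map (φ : K →+* L) → L) '' (J.map (subringMapEquiv φ S) : Set (S.map (φ : K →+* L))) =
      φ '' (((↑) : S → K) '' (J : Set S)) := by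
  ext w
  simp only [Set.mem_image, SetLike.mem_coe]
  constructor
  · rintro ⟨w', hw', rfl⟩
    obtain ⟨z, hz, rfl⟩ := (Ideal.mem_map_of_equiv (subringMapEquiv φ S) w').mp hw'
    exact ⟨z, ⟨z, hz, rfl⟩, rfl⟩
  · rintro ⟨_, ⟨z, hz, rfl⟩, rfl⟩
    exact ⟨subringMapEquiv φ S z, Ideal.mem_map_of_mem _ hz, rfl⟩

/-! ## The node map -/

/-- Transport of a marked node along `φ`: `⟨S, J⟩ ↦ ⟨φ(S), φ(J)⟩`. [folklore] -/
def nodeMap (φ : K ≃+* L) (n : MarkedNode K) : MarkedNode L :=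
  ⟨n.1.map (φ : K →+* L), n.2.map (subringMapEquiv φ n.1)⟩

/-- First component of the node map. [folklore] -/
theorem nodeMap_fst (φ : K ≃+* L) (n : MarkedNode K) : (nodeMap φ n).1 = n.1.map (φ : K →+* L) := rfl

/-- Second component of the node map. [folklore] -/
theorem nodeMap_snd (φ : K ≃+* L) (n : MarkedNode K) :
    (nodeMap φ n).2 = n.2.map (subringMapEquiv φ n.1) := rfl

/-- `φ⁻¹(φ(S)) = S`. [folklore] -/
theorem map_symm_map (φ : K ≃+* L) (S : Subring K) :
    (S.map (φ : K →+* L)).map (φ.symm : L →+* K) = S := by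
  ext z
  constructor
  · intro hz
    obtain ⟨w, hw, hwz⟩ := Subring.mem_map.mp hz
    obtain ⟨z', hz', rfl⟩ := Subring.mem_map.mp hw
    rw [← hwz]
    change φ.symm (φ z') ∈ S
    rwa [φ.symm_apply_apply]
  · intro hz
    exact Subring.mem_map.mpr ⟨φ z, Subring.mem_map.mpr ⟨z, hz, rfl⟩, φ.symm_apply_apply z⟩

/-- **Round trip**: `nodeMap φ⁻¹ ∘ nodeMap φ = id`. [folklore] -/
theorem nodeMap_symm_nodeMap (φ : K ≃+* L) (n : MarkedNode K) : nodeMap φ.symm (nodeMap φ n) = n := by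
  refine MarkedNode.ext_of_image (map_symm_map φ n.1) ?_
  change ((↑) : (n.1.map (φ : K →+* L)).map (φ.symm : L →+* K) → K) ''
      ((n.2.map (subringMapEquiv φ n.1)).map (subringMapEquiv φ.symm (n.1.map (φ : K →+* L))) : Set _) =
    ((↑) : n.1 → K) '' (n.2 : Set n.1)
  rw [coe_image_map_subringMapEquiv, coe_image_map_subringMapEquiv, ← Set.image_comp]
  convert Set.image_id _
  ext z
  exact φ.symm_apply_apply z

/-- The node map is injective. [folklore] -/
theorem nodeMap_injective (φ : K ≃+* L) : Function.Injective (nodeMap (K := K) (L := L) φ) :=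
  fun n m h => by rw [← nodeMap_symm_nodeMap φ n, h, nodeMap_symm_nodeMap]

/-! ## Invariance of the node predicates -/

/-- `Frac S = K` transports to `Frac φ(S) = L`. [folklore] -/
theorem isLocalRingOf_map (φ : K ≃+* L) {S : Subring K} (h : IsLocalRingOf S) :
    IsLocalRingOf (S.map (φ : K →+* L)) := by
  obtain ⟨hloc, hfrac⟩ := h
  refine ⟨(subringMapEquiv φ S).isLocalRing, fun w => ?_⟩
  obtain ⟨a, ha, c, hc, hc0, hz⟩ := hfrac (φ.symm w)
  refine ⟨φ a, Subring.mem_map.mpr ⟨a, ha, rfl⟩, φ c, Subring.mem_map.mpr ⟨c, hc, rfl⟩,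
    (map_ne_zero φ).mpr hc0, ?_⟩
  rw [← map_div₀, ← hz, RingEquiv.apply_symm_apply]

/-- `J ⊆ 𝔪_S^k` iff `φ(J) ⊆ 𝔪_{φ(S)}^k`. [folklore] -/
theorem map_le_pow_maximalIdeal_iff (φ : K ≃+* L) {S : Subring K} [IsLocalRing S]
    [IsLocalRing (S.map (φ : K →+* L))] (J : Ideal S) (k : ℕ) :
    J.map (subringMapEquiv φ S) ≤ maximalIdeal (S.map (φ : K →+* L)) ^ k ↔ J ≤ maximalIdeal S ^ k := by
  rw [← IsLocalRing.map_ringEquiv_maximalIdeal (subringMapEquiv φ S), ← Ideal.map_pow]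
  constructor
  · intro h
    have := Ideal.map_mono (f := (subringMapEquiv φ S).symm) h
    rwa [map_map_symm_of_equiv, map_map_symm_of_equiv] at this
  · exact fun h => Ideal.map_mono h

/-- Singular nodes transport. [folklore] -/
theorem isSingularNode_nodeMap (φ : K ≃+* L) {b : ℕ} {n : MarkedNode K} (h : IsSingularNode b n) :
    IsSingularNode b (nodeMap φ n) := by
  obtain ⟨hreg, hdim, hof, hle⟩ := h
  haveI := hreg
  haveI hreg' : IsRegularLocalRing (n.1.map (φ : K →+* L)) :=
    IsRegularLocalRing.of_ringEquiv (subringMapEquiv φ n.1)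
  refine ⟨hreg', ?_, isLocalRingOf_map φ hof, ?_⟩
  · change ringKrullDim (n.1.map (φ : K →+* L)) = 2
    rw [← ringKrullDim_eq_of_ringEquiv (subringMapEquiv φ n.1), hdim]
  · exact (map_le_pow_maximalIdeal_iff φ n.2 b).mpr hle

/-- Tame nodes transport. [folklore] -/
theorem isTameNode_nodeMap (φ : K ≃+* L) {b : ℕ} {n : MarkedNode K} (h : IsTameNode b n) :
    IsTameNode b (nodeMap φ n) := by
  obtain ⟨hreg, hdim, hof, hle, hnot⟩ := h
  haveI := hreg
  haveI hreg' : IsRegularLocalRing (n.1.map (φ : K →+* L)) :=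
    IsRegularLocalRing.of_ringEquiv (subringMapEquiv φ n.1)
  refine ⟨hreg', ?_, isLocalRingOf_map φ hof, ?_, ?_⟩
  · change ringKrullDim (n.1.map (φ : K →+* L)) = 2
    rw [← ringKrullDim_eq_of_ringEquiv (subringMapEquiv φ n.1), hdim]
  · exact (map_le_pow_maximalIdeal_iff φ n.2 b).mpr hle
  · exact fun h => hnot ((map_le_pow_maximalIdeal_iff φ n.2 (2 * b)).mp h)

/-- Quadratic transforms transport along a field isomorphism (the tree's `isQuadraticTransform_comap` along
`φ⁻¹ : L →+* K`, whose pull-back is the image under `φ`). [folklore] -/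
theorem isQuadraticTransform_map (φ : K ≃+* L) {S S' : Subring K} (h : IsQuadraticTransform S S') :
    IsQuadraticTransform (S.map (φ : K →+* L)) (S'.map (φ : K →+* L)) := by
  rw [Subring.map_equiv_eq_comap_symm, Subring.map_equiv_eq_comap_symm]
  refine isQuadraticTransform_comap (ι := (φ.symm : L →+* K)) (fun z _ => ⟨φ z, ?_⟩) h
  exact φ.symm_apply_apply z

/-! ## Invariance of the controlled transform -/

section Ctrl

variable (φ : K ≃+* L) {S : Subring K}

/-- Extension of ideals transports: `φ(J S') = φ(J) φ(S')`. [folklore] -/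
theorem map_extIdeal (J : Ideal S) (S' : Subring K) :
    (extIdeal J S').map (subringMapEquiv φ S') =
      extIdeal (J.map (subringMapEquiv φ S)) (S'.map (φ : K →+* L)) := by
  rw [extIdeal, extIdeal, Ideal.map_span]
  congr 1
  ext w
  rw [Set.mem_setOf_eq, coe_image_map_subringMapEquiv]
  constructor
  · rintro ⟨z, hz, rfl⟩
    rw [Set.mem_setOf_eq] at hz
    obtain ⟨j, hj, hjz⟩ := hz
    exact ⟨(j : K), ⟨j, hj, rfl⟩, by rw [coe_subringMapEquiv, hjz]⟩
  · rintro ⟨_, ⟨j, hj, rfl⟩, hw⟩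
    refine ⟨(subringMapEquiv φ S').symm w, ?_, (subringMapEquiv φ S').apply_symm_apply w⟩
    rw [Set.mem_setOf_eq]
    refine ⟨j, hj, φ.injective ?_⟩
    have e : ((subringMapEquiv φ S' ((subringMapEquiv φ S').symm w) : S'.map (φ : K →+* L)) : L) = (w : L) := by
      rw [(subringMapEquiv φ S').apply_symm_apply]
    rw [coe_subringMapEquiv] at e
    rw [e, hw]

/-- **The controlled transform transports**: `φ((J S' : (𝔪_S S')^b)) = (φ(J) φ(S') : (𝔪_{φ(S)} φ(S'))^b)`.
[folklore] -/
theorem map_ctrlTransform [IsLocalRing S] [IsLocalRing (S.map (φ : K →+* L))] (b : ℕ) (J : Ideal S)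
    (S' : Subring K) :
    (ctrlTransform b S J S').map (subringMapEquiv φ S') =
      ctrlTransform b (S.map (φ : K →+* L)) (J.map (subringMapEquiv φ S)) (S'.map (φ : K →+* L)) := by
  rw [ctrlTransform, ctrlTransform, map_colon_of_equiv, Ideal.map_pow, map_extIdeal, map_extIdeal,
    IsLocalRing.map_ringEquiv_maximalIdeal]

end Ctrl

/-! ## Steps, reachability and the tree -/

/-- Marked steps transport. [folklore] -/
theorem markedStep_nodeMap (φ : K ≃+* L) {b : ℕ} {n n' : MarkedNode K} (h : MarkedStep b n n') :
    MarkedStep b (nodeMap φ n) (nodeMap φ n') := by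
  obtain ⟨ht, hloc, hq, hd, he⟩ := h
  haveI := hloc
  haveI hloc' : IsLocalRing (n.1.map (φ : K →+* L)) := (subringMapEquiv φ n.1).isLocalRing
  refine ⟨isTameNode_nodeMap φ ht, hloc', isQuadraticTransform_map φ hq, ?_, ?_⟩
  · change ringKrullDim (n'.1.map (φ : K →+* L)) = 2
    rw [← ringKrullDim_eq_of_ringEquiv (subringMapEquiv φ n'.1), hd]
  · change n'.2.map (subringMapEquiv φ n'.1) =
      ctrlTransform b (n.1.map (φ : K →+* L)) (n.2.map (subringMapEquiv φ n.1)) (n'.1.map (φ : K →+* L))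
    rw [he, map_ctrlTransform]

/-- Reachability transports. [folklore] -/
theorem reflTransGen_markedStep_nodeMap (φ : K ≃+* L) {b : ℕ} {n m : MarkedNode K}
    (h : Relation.ReflTransGen (MarkedStep b) n m) :
    Relation.ReflTransGen (MarkedStep b) (nodeMap φ n) (nodeMap φ m) := by
  induction h with
  | refl => exact Relation.ReflTransGen.refl
  | tail _ hs ih => exact ih.tail (markedStep_nodeMap φ hs)

/-- The tree transports into the tree. [folklore] -/
theorem nodeMap_mem_exitTree (φ : K ≃+* L) {b : ℕ} {n₀ m : MarkedNode K} (h : m ∈ exitTree b n₀) :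
    nodeMap φ m ∈ exitTree b (nodeMap φ n₀) :=
  ⟨reflTransGen_markedStep_nodeMap φ h.1, isSingularNode_nodeMap φ h.2⟩

/-- **The tree transports onto the tree.** [folklore] -/
theorem image_nodeMap_exitTree (φ : K ≃+* L) (b : ℕ) (n₀ : MarkedNode K) :
    nodeMap φ '' exitTree b n₀ = exitTree b (nodeMap φ n₀) := by
  apply le_antisymm
  · rintro _ ⟨m, hm, rfl⟩
    exact nodeMap_mem_exitTree φ hm
  · intro m hm
    refine ⟨nodeMap φ.symm m, ?_, ?_⟩
    · have := nodeMap_mem_exitTree φ.symm hm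
      rwa [nodeMap_symm_nodeMap] at this
    · have := nodeMap_symm_nodeMap φ.symm m
      rwa [RingEquiv.symm_symm] at this

/-- **The exit count is invariant under field isomorphisms**: `ν(φ S, φ J, b) = ν(S, J, b)`.
[cite: ZariskiSamuel1960, Appendix 5] -/
theorem exitCount_map_ringEquiv (φ : K ≃+* L) (b : ℕ) (S : Subring K) (J : Ideal S) :
    exitCount b (S.map (φ : K →+* L)) (J.map (subringMapEquiv φ S)) = exitCount b S J := by
  rw [exitCount, exitCount, show (⟨S.map (φ : K →+* L), J.map (subringMapEquiv φ S)⟩ : MarkedNode L) =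
      nodeMap φ ⟨S, J⟩ from rfl, ← image_nodeMap_exitTree, Set.ncard_image_of_injective _ (nodeMap_injective φ)]

end Summit.ResolutionOfSingularities.ResolutionOfSingularities.Theorems.CampaignW46

end
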